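import Summits.QuantumFields.YangMills.Theorems.BalabanUVNodesN11BgProvisoOnOneBlockTail

/-!
# DAG node N11 — THE bg-FACTS FAMILY BELOW THE FLOOR, COMPLETELY: for a one-block tail above `n₀`, the tokens `BgProvisoΛ … m (Supp m) (U m)` of ALL history lengths `m ≥ n₀` follow from
# (A) the token of the length-`n₀` family (print's regime — the guarded row P11 applies there), (B) def-R's TRANSPORT along no-expansion steps (`U_{m+1}(s) = U_m(init s)`, `Supp_{m+1}(s) ⊆
# Supp_m(init s)` when `Ω_{m+1}(s) = ∅`), (C) GLOBAL REGULARITY of the all-small histories (`spaceI` on every domain at every all-small level) and (D) the LARGE-FIELD SPACE at switch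
# levels — by induction on the length: dead tops inherit every clause from their truncation, present tops are all-small below and ask only (C)/(D)

HEADER — WORK-UNIT METADATA.  Cell `pub-ymgap`, YM-PLAN Track A (HUMAN RULING D-0062 ∕ D-0149 width seats), seat `pub-ymgap-dag-n11-w4` (g5; WIDTH SEAT 4 of 4 on NODE n11
[B14]), route `BalabanUVNodes` rev 29, deciding item K1⁹ `StabilityBRunRowsAtRecordR13SepCoPHV` = stmt-QuantumFields-27364 (helper lane, `--kind proof --supports 27364 --as helper`,
count-neutral).  [III] = [Balaban1988Convergent], [I] = [Balaban1987RG1].  Over this seat's `…N11BgProvisoOnOneBlockTail` (`bgClause_of_init_of_dead`, `bgClause_of_dead`,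
`bgClause_iff_spaceI_of_allSmall`, `bgClause_iff_spaceMS_of_switch`), p634387 `…N11OneBlockTailHistories` (`allSmall_below_of_Λ_eq_univ`, `dead_above_of_Λ_eq_empty`), p618164
`…N11OneBlockLevels` (`∅ ∕ T` at one-block levels), def-R's `Node00.BgProvisoΛ`.

WHY THIS FILE.  dag-n11-w1's bg-facts road displays `hbgs : ∀ k ≤ K, BgProvisoΛ … k (suppOfRecord₁₃SepCoP … k) (UbgOfRecord₁₃CoP … k)` — one token per history LENGTH `k`, up to
level `k`.  Above the floor (`k ≤ n₀`) K0's guarded row P11 delivers it; below (`k > n₀`, one-block levels) `…BgProvisoOnOneBlockTail` reduced the TAIL-level clauses of each family to two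
suppliers but left its PREFIX-level clauses (levels `≤ n₀` of long histories) displayed.  THIS FILE closes that gap by INDUCTION ON THE LENGTH: a long history is either DEAD at its top —
then def-R's background and support set are those of its truncation (at the record: dag-n11-d's `UbgOfRecord₁₃CoP_succ_eq_init_of_Omega_empty`; the support-set inclusion is displayed),
so EVERY clause is inherited (`bgClause_of_init_of_dead`) — or PRESENT at its top, hence ALL-SMALL at every lower level ((2.1)), so its clauses at every level are the global-regularity
supplier (C) (all-small levels, prefix included) or the switch supplier (D) (the top, if `Λ = ∅`).  Net: the whole family `k > n₀` = (A) the length-`n₀` token + (B) transport + (C) + (D);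
nothing of [III] §3 ∕ [15] per-cube analysis at genuinely mixed histories is asked below the floor.

WHAT THIS FILE PROVES (0 `sorry`, 0 `def`; standard axioms; an induction on the tree's own (2.1)-chains and def-R's displayed token).
★★★ `bgProvisoΛ_family_of_oneBlockTail_le` (generic families `Supp m`, `U m` of every length; `M ≥ 1`; levels `n₀ < j ≤ K′` one-block; (A)–(D) ⟹ `BgProvisoΛ … m (Supp m) (U m)` for every
`n₀ ≤ m ≤ K′`) · ★★★ `bgProvisoΛ_family_of_flowIneq26` (along a windowed (2.6)-run at `M = L^a`, `r = 1`: `n₀` = p633302's last compatible level, handed to the supplier side together with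
`PartCompat₁₃ θ p n₀` and the one-block tail; (A) = every length `m ≤ n₀` (the guarded regime), (B)–(D) on the tail ⟹ the token for EVERY length `m ≤ K`).

HONEST FRAMING.  Helper lane of K1⁹; count-neutral; the four inputs (A)–(D) are HYPOTHESES (def-R's token memberships = [III] (2.28) ∕ [15] Thm 1 content; the transport (B) is def-R's —
its `U`-half is dag-n11-d's theorem at the record, its `Supp`-half displayed); nothing of Bałaban asserted; NOT a discharge.  N11 NOT discharged; K1⁹ NOT closed, no registered stub of v9∕v10
touched; counts unmoved (typed 28∕28 · discharged 5∕27 · A 5∕28).  One finite `𝕋⁴_{L^K}` programme at fixed `ε = L^{−K}`; R4 closes only the conditional finite-𝕋⁴ rung `BalabanLadder.UV`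
— NOT ℝ⁴, NOT OS, NOT a mass gap, NOT Clay.  No `sorry`, `axiom`, `def`, `instance`, `notation`.  Sources (SHAPE ∕ bookkeeping only): [III] (2.1)–(2.3) pp.254–255, (2.12)–(2.13) pp.256–257,
(2.17) p.257, (2.27)–(2.28) p.259, (2.41)(i) p.261, (2.6) p.255; [I] (0.1) p.251.
-/

noncomputable section

open scoped Matrix.Norms.L2Operator

namespace Summit.QuantumFields.YangMills.Theorems.BalabanUVNodesN11BgProvisoFamilyBelowFloor

open Literature.MathematicalPhysics.QuantumFieldTheory.Balaban1983to89 T4Continuum Node00 B14.Eq218Concrete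
open BalabanUVNodesN11OneBlockLevels (eq_empty_or_eq_univ_of_mem_unionsOfCubes_of_le)
open BalabanUVNodesN11OneBlockTailHistories (allSmall_below_of_Λ_eq_univ dead_above_of_Λ_eq_empty)
open BalabanUVNodesN11BgProvisoOnOneBlockTail (bgClause_of_init_of_dead bgClause_of_dead bgClause_iff_spaceI_of_allSmall bgClause_iff_spaceMS_of_switch)
open BalabanUVNodesN11CompatibleInitialSegmentSplit (exists_lastCompatibleLevel_of_window_of_flowIneq26)

variable {F : T4Family} {N : ℕ} {𝔸 : Type*} [NormedRing 𝔸] [NormedAlgebra ℂ 𝔸] [CompleteSpace 𝔸]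

section Family

variable {K : ℕ} {S : Sect2.Setting 𝔸 (SU N)} {Rz : Sect2.Residual (F.P K) 𝔸} {ν : Stage7Numerics} {M : ℕ} {g : ℕ → ℝ}
  (Supp : (m : ℕ) → SeqOfRecord F ν M g K m → Set (B15DeterminingSets.MSField (F.P K) (SU N))) (U : (m : ℕ) → SeqOfRecord F ν M g K m → BgMap F N K)

/-- **★★ THE bg-FACTS FAMILY BELOW THE FLOOR, UP TO A TOP LENGTH `K′`**: if the levels `n₀ < j ≤ K′` are ONE-BLOCK (`M ≥ 1`), then from (A) the token of the length-`n₀` family, (B) def-R's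
transport along no-expansion tops (`U (m+1) s = U m (init s)`, `Supp (m+1) s ⊆ Supp m (init s)` when `Ω_{m+1}(s) = ∅`, `n₀ ≤ m < K′`), (C) the all-small supplier (`spaceI` on every domain
at every level `j ≤ m` of a length-`m` history all-small through `j`, `n₀ < m ≤ K′`) and (D) the switch supplier (`spaceMS` at a level `n₀ < j ≤ m` with the history all-small below `j`,
`(T,∅)` at `j`, dead above), EVERY token `BgProvisoΛ … m (Supp m) (U m)`, `n₀ ≤ m ≤ K′`, follows — induction on `m`: a dead top inherits all clauses from its truncation, a present top
is all-small below. [cite: Balaban1988Convergent, (2.1)–(2.3) pp.254–255, (2.12)–(2.13) pp.256–257, (2.17) p.257, (2.27)–(2.28) p.259, (2.41)(i) p.261] -/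
theorem bgProvisoΛ_family_of_oneBlockTail_le (hM : 1 ≤ M) {n₀ K' : ℕ}
    (hpre : BgProvisoΛ F N K S Rz M n₀ (Supp n₀) (U n₀))
    (hone : ∀ j, n₀ < j → j ≤ K' → (F.P K).sitesPerDir 0 ≤ dCubeSide (F.P K).L M (RkOfRecord (F.P K).L ν.r (g j)) j)
    (hU : ∀ m, n₀ ≤ m → m < K' → ∀ s : SeqOfRecord F ν M g K (m + 1), s.Ω (m + 1) = ∅ → U (m + 1) s = U m s.init)
    (hS : ∀ m, n₀ ≤ m → m < K' → ∀ s : SeqOfRecord F ν M g K (m + 1), s.Ω (m + 1) = ∅ → Supp (m + 1) s ⊆ Supp m s.init)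
    (hI : ∀ m, n₀ < m → m ≤ K' → ∀ (s : SeqOfRecord F ν M g K m) (W : B15DeterminingSets.MSField (F.P K) (SU N)), W ∈ Supp m s →
      ∀ j, 1 ≤ j → j ≤ m → (∀ i, 1 ≤ i → i ≤ j → s.Ω i = Set.univ ∧ s.Λ i = Set.univ) → ∀ X : (Sect2.domSys (F.P K) M j).Dom,
        Sect2.ofBackgroundC S.ι (U m s W) ∈ Sect2.spaceI S Rz M j (Sect2.domSites (F.P K) M j X) (S.lf.alpha0 (S.flow.g j)) (S.lf.alpha1 (S.flow.g j)))
    (hMS : ∀ m, n₀ < m → m ≤ K' → ∀ (s : SeqOfRecord F ν M g K m) (W : B15DeterminingSets.MSField (F.P K) (SU N)), W ∈ Supp m s →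
      ∀ j, n₀ < j → j ≤ m → (∀ i, 1 ≤ i → i < j → s.Ω i = Set.univ ∧ s.Λ i = Set.univ) → s.Ω j = Set.univ → s.Λ j = ∅ →
        (∀ i, j < i → i ≤ m → s.Ω i = ∅ ∧ s.Λ i = ∅) → ∀ X : (Sect2.domSys (F.P K) M j).Dom,
          Sect2.ofBackgroundC S.ι (U m s W) ∈ Sect2.spaceMS S Rz M j (Sect2.domSites (F.P K) M j X) s.Ω) :
    ∀ m, n₀ ≤ m → m ≤ K' → BgProvisoΛ F N K S Rz M m (Supp m) (U m) := by
  intro m hm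
  induction m, hm using Nat.le_induction with
  | base => exact fun _ => hpre
  | succ m hm ih =>
    intro hmK
    have ihm := ih (by omega)
    intro s W hW j h1 hj X
    -- the top level `m + 1` is one-block: `Ω_{m+1}, Λ_{m+1} ∈ {∅, T}`
    have honeT := hone (m + 1) (by omega) hmK
    rcases eq_empty_or_eq_univ_of_mem_unionsOfCubes_of_le honeT (s.chain.memΩ (m + 1) (by omega) le_rfl) with hΩ | hΩ
    · -- DEAD TOP: the top clause is free, every lower clause is inherited from the truncation
      rcases hj.eq_or_lt with rfl | hjm
      · have hsub : s.Λ (m + 1) ⊆ s.Ω (m + 1) := s.chain.Λ_subset (m + 1) (by omega) le_rfl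
        rw [hΩ] at hsub
        exact bgClause_of_dead S Rz hM s hΩ (Set.eq_empty_of_subset_empty hsub) (U (m + 1) s W) X
      · exact bgClause_of_init_of_dead ihm s hΩ (hU m hm (by omega) s hΩ) (hS m hm (by omega) s hΩ) hW h1 (by omega) X
    · -- PRESENT TOP: all-small below the top
      rcases eq_empty_or_eq_univ_of_mem_unionsOfCubes_of_le honeT (s.chain.memΛ (m + 1) (by omega) le_rfl) with hΛ | hΛ
      · -- switch at the top: levels `≤ m` all-small, level `m + 1` is `(T, ∅)`
        have hbelow : ∀ i, 1 ≤ i → i ≤ m → s.Ω i = Set.univ ∧ s.Λ i = Set.univ := by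
          intro i hi1 him
          rcases Nat.eq_zero_or_pos m with hm0 | hm0
          · omega
          · have hsub : s.Ω (m + 1) ⊆ s.Λ m := s.chain.Ω_succ_subset m hm0 (Nat.lt_succ_self m)
            rw [hΩ] at hsub
            exact allSmall_below_of_Λ_eq_univ s (Nat.le_succ m) (Set.eq_univ_of_univ_subset hsub) hi1 him
        rcases hj.eq_or_lt with rfl | hjm
        · exact (bgClause_iff_spaceMS_of_switch S Rz hM s hΩ hΛ (U (m + 1) s W) X).2
            (hMS (m + 1) (by omega) hmK s W hW (m + 1) (by omega) le_rfl (fun i hi1 hij => hbelow i hi1 (by omega)) hΩ hΛ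
              (fun i hji hi => absurd hi (by omega)) X)
        · have hΛj : s.Λ j = Set.univ := (hbelow j h1 (by omega)).2
          exact (bgClause_iff_spaceI_of_allSmall S Rz s hΛj (U (m + 1) s W) X).2
            (hI (m + 1) (by omega) hmK s W hW j h1 hj (fun i hi1 hij => hbelow i hi1 (by omega)) X)
      · -- all small through the top
        have hall : ∀ i, 1 ≤ i → i ≤ m + 1 → s.Ω i = Set.univ ∧ s.Λ i = Set.univ :=
          fun i hi1 him => allSmall_below_of_Λ_eq_univ s le_rfl hΛ hi1 him
        have hΛj : s.Λ j = Set.univ := (hall j h1 hj).2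
        exact (bgClause_iff_spaceI_of_allSmall S Rz s hΛj (U (m + 1) s W) X).2
          (hI (m + 1) (by omega) hmK s W hW j h1 hj (fun i hi1 hij => hall i hi1 (hij.trans hj)) X)

end Family

/-! ## §2  Along a windowed (2.6)-run: `n₀` = the last compatible level of p633302 -/

section Run

variable [NeZero N] {S : Sect2.Setting 𝔸 (SU N)}

/-- **★★★ THE bg-FACTS FAMILY OF A (2.6)-RUN BELOW THE FLOOR** (generic θ, `θ.τ9.M = F.L^a`, `θ.ν.r = 1`, window `]0, γ]`, (2.6) with `0 ≤ β⁺`, `β⁺·γ² ≤ 1`): the supplier side is handed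
p633302's last compatible level `n₀ ≤ K` with `PartCompat₁₃ θ p n₀` (so K0's guarded row P11 serves (A)) and the one-block tail; from (A) at `n₀`, the transport (B) and the suppliers
(C)/(D) on the lengths `n₀ < m ≤ K`, every token `BgProvisoΛ … m (Supp m) (U m)`, `m ≤ K`, follows (for `m ≤ n₀` the supplier side hands the guarded regime `hlow` directly — the
lengths differ, so no monotonicity shortcut). [cite: Balaban1988Convergent, (2.6) p.255, (2.1)–(2.3) pp.254–255, (2.27)–(2.28) p.259, (2.41)(i) p.261, p.257; Balaban1987RG1, (0.1) p.251] -/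
theorem bgProvisoΛ_family_of_flowIneq26 (θ : Stage13Params F N) {a : ℕ} (hMa : θ.τ9.M = F.L ^ a) (hr : θ.ν.r = 1)
    (p : B12.RunParams) {γ βup β₀ : ℝ} (hβ : 0 ≤ βup) (hβγ : βup * γ ^ 2 ≤ 1)
    (hW : Step.InInterval γ p.K (gOfRecord₁₃ F N θ p))
    (h26 : B14.FlowIneq26 (gOfRecord₁₃ F N θ p) βup β₀ p.K)
    {Rz : Sect2.Residual (F.P p.K) 𝔸}
    (Supp : (m : ℕ) → SeqOfRecord F θ.ν θ.τ9.M (gOfRecord₁₃ F N θ p) p.K m → Set (B15DeterminingSets.MSField (F.P p.K) (SU N)))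
    (U : (m : ℕ) → SeqOfRecord F θ.ν θ.τ9.M (gOfRecord₁₃ F N θ p) p.K m → BgMap F N p.K)
    (hsupply : ∀ n₀, n₀ ≤ p.K → PartCompat₁₃ F N θ p n₀ →
      (∀ j, n₀ < j → j ≤ p.K → (F.P p.K).sitesPerDir 0 < dCubeSide (F.P p.K).L θ.τ9.M (RkOfRecord (F.P p.K).L θ.ν.r (gOfRecord₁₃ F N θ p j)) j) →
      -- (A) the guarded regime: every length `m ≤ n₀`
      (∀ m, m ≤ n₀ → BgProvisoΛ F N p.K S Rz θ.τ9.M m (Supp m) (U m)) ∧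
      -- (B) transport along no-expansion tops on the tail
      (∀ m, n₀ ≤ m → m < p.K → ∀ s : SeqOfRecord F θ.ν θ.τ9.M (gOfRecord₁₃ F N θ p) p.K (m + 1), s.Ω (m + 1) = ∅ →
        U (m + 1) s = U m s.init ∧ Supp (m + 1) s ⊆ Supp m s.init) ∧
      -- (C) global regularity of the all-small histories
      (∀ m, n₀ < m → m ≤ p.K → ∀ (s : SeqOfRecord F θ.ν θ.τ9.M (gOfRecord₁₃ F N θ p) p.K m) (W : B15DeterminingSets.MSField (F.P p.K) (SU N)), W ∈ Supp m s →
        ∀ j, 1 ≤ j → j ≤ m → (∀ i, 1 ≤ i → i ≤ j → s.Ω i = Set.univ ∧ s.Λ i = Set.univ) → ∀ X : (Sect2.domSys (F.P p.K) θ.τ9.M j).Dom,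
          Sect2.ofBackgroundC S.ι (U m s W) ∈ Sect2.spaceI S Rz θ.τ9.M j (Sect2.domSites (F.P p.K) θ.τ9.M j X) (S.lf.alpha0 (S.flow.g j)) (S.lf.alpha1 (S.flow.g j))) ∧
      -- (D) the large-field space at switch levels
      (∀ m, n₀ < m → m ≤ p.K → ∀ (s : SeqOfRecord F θ.ν θ.τ9.M (gOfRecord₁₃ F N θ p) p.K m) (W : B15DeterminingSets.MSField (F.P p.K) (SU N)), W ∈ Supp m s →
        ∀ j, n₀ < j → j ≤ m → (∀ i, 1 ≤ i → i < j → s.Ω i = Set.univ ∧ s.Λ i = Set.univ) → s.Ω j = Set.univ → s.Λ j = ∅ →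
          (∀ i, j < i → i ≤ m → s.Ω i = ∅ ∧ s.Λ i = ∅) → ∀ X : (Sect2.domSys (F.P p.K) θ.τ9.M j).Dom,
            Sect2.ofBackgroundC S.ι (U m s W) ∈ Sect2.spaceMS S Rz θ.τ9.M j (Sect2.domSites (F.P p.K) θ.τ9.M j X) s.Ω)) :
    ∀ m, m ≤ p.K → BgProvisoΛ F N p.K S Rz θ.τ9.M m (Supp m) (U m) := by
  have hM : 1 ≤ θ.τ9.M := by rw [hMa]; exact Nat.one_le_pow _ _ (by have := F.hL11; omega)
  obtain ⟨n₀, hn₀, hPC, htail⟩ := exists_lastCompatibleLevel_of_window_of_flowIneq26 θ hMa hr p hβ hβγ hW h26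
  obtain ⟨hlow, hB, hC, hD⟩ := hsupply n₀ hn₀ hPC htail
  intro m hm
  by_cases hmn : m ≤ n₀
  · exact hlow m hmn
  · exact bgProvisoΛ_family_of_oneBlockTail_le Supp U hM (hlow n₀ le_rfl) (fun j hj hjK => (htail j hj hjK).le)
      (fun m hm hmK s hΩ => (hB m hm hmK s hΩ).1) (fun m hm hmK s hΩ => (hB m hm hmK s hΩ).2) hC hD m (by omega) hm

end Run

end Summit.QuantumFields.YangMills.Theorems.BalabanUVNodesN11BgProvisoFamilyBelowFloor

end
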